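import Summits.KontsevichZagierPeriods.KontsevichZagierPeriods.Theorems.GammaHodgeSector.Negative.LoadBearing
import Literature.NumberTheory.Transcendental.GammaMonomialsProofs

/-!
# `GammaHodgeSector` (stmt-KontsevichZagierPeriods-3742) — negative side III: `IsAlgebraic ℚ c`
is decoration

Landed copy of §4 of `Cruxes/GammaHodgeSector/Disproof.lean`: a `ℚ`-semialgebraic function takes
algebraic values at rational points (`isAlgebraic_apply_ratCast`, through a rational-coefficient
clopen decomposition of semialgebraic subsets of `ℝ¹`, `exists_clopen_off_zeros`, and
`isAlgebraic_of_isSemialgebraic_singleton`); the pinned integrand of `r'` at `(0,…,0,½,…,½)`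
is an algebraic non-zero multiple of `c`, so `IsAlgebraic ℚ c` follows from the pinning alone
(`isAlgebraic_of_isBallCubeRep`, `gammaHodgeSector_iff_without_isAlgebraic`).
-/

noncomputable section

open MeasureTheory Set
open scoped BigOperators

namespace Summit.KontsevichZagierPeriods.GammaHodgeSectorNegative

open Literature.NumberTheory.Transcendental
open Literature.NumberTheory.Transcendental.KZ
open Literature.ModelTheory.ExponentialFields (IsSemialgebraic isSemialgebraic_univ)
open Summit.KontsevichZagierPeriods.KontsevichZagierPeriods.Theses.TerasomaMultiplication (GammaHodgeSector)

/-! ## §4 `IsAlgebraic ℚ c` is decoration: it follows from the pinning of `r'`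

A `ℚ`-semialgebraic function takes algebraic values at rational points of its domain; the pinned
integrand of `r'` at the rational point `(0,…,0,½,…,½)` is `c · k! · 4^{Σ(1 − x'_l … )}`-ish, an
algebraic non-zero multiple of `c`. So hypothesis `IsAlgebraic ℚ c` of the crux is implied by the
mere existence of `r'` (`isAlgebraic_of_isBallCubeRep`) and can never be the reason an instance
is vacuous. -/

section Algebraicity

open Literature.ModelTheory.ExponentialFields in
/-- Evaluation of a polynomial in one variable `X₀` with rational coefficients factors through the
univariate polynomial obtained by `X₀ ↦ X`. [folklore] -/
theorem aeval_eq_aeval_uni (p : MvPolynomial (Fin 1) ℚ) (w : Fin 1 → ℝ) :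
    MvPolynomial.aeval w p =
      Polynomial.aeval (w 0) (MvPolynomial.aeval (fun _ : Fin 1 => (Polynomial.X : Polynomial ℚ)) p) := by
  induction p using MvPolynomial.induction_on with
  | C a => simp
  | add p q hp hq => simp only [map_add, hp, hq]
  | mul_X p i hp =>
    have hi : i = 0 := Subsingleton.elim _ _
    subst hi
    simp only [map_mul, hp, MvPolynomial.aeval_X, Polynomial.aeval_X]

open Literature.ModelTheory.ExponentialFields in
/-- **Dimension one, rational coefficients.** Every `ℚ`-semialgebraic subset of `ℝ¹` is, off the
zero set of some non-zero RATIONAL polynomial, both open and closed (induction over the Boolean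
algebra; cf. the real-coefficient version `NoSemialgPrim.exists_ne_zero_isOpen` of the barrier
file `AlgebraicPrimitivesObstruction`). [folklore] -/
theorem exists_clopen_off_zeros {S : Set (Fin 1 → ℝ)} (hS : IsSemialgebraic ℚ S) :
    ∃ q : Polynomial ℚ, q ≠ 0 ∧ IsOpen (S ∩ {w | Polynomial.aeval (w 0) q ≠ 0}) ∧
      IsOpen (Sᶜ ∩ {w | Polynomial.aeval (w 0) q ≠ 0}) := by
  have hcont : ∀ q : Polynomial ℚ, Continuous fun w : Fin 1 → ℝ => Polynomial.aeval (w 0) q :=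
    fun q => (Polynomial.continuous_aeval q).comp (continuous_apply 0)
  unfold IsSemialgebraic semialgebraicSets at hS
  induction hS using BooleanSubalgebra.closure_bot_sup_induction with
  | mem S hS =>
    rcases hS with ⟨p, rfl⟩ | ⟨p, rfl⟩
    · set q := MvPolynomial.aeval (fun _ : Fin 1 => (Polynomial.X : Polynomial ℚ)) p with hq
      have hpq : ∀ w : Fin 1 → ℝ, MvPolynomial.aeval w p = Polynomial.aeval (w 0) q :=
        aeval_eq_aeval_uni p
      by_cases hq0 : q = 0
      · refine ⟨1, one_ne_zero, ?_, ?_⟩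
        · convert isOpen_univ
          ext w
          simp [hpq, hq0]
        · convert isOpen_empty
          ext w
          simp [hpq, hq0]
      · refine ⟨q, hq0, ?_, ?_⟩
        · convert isOpen_empty
          ext w
          simp only [mem_inter_iff, mem_setOf_eq, hpq, mem_empty_iff_false, iff_false, not_and,
            not_not]
          exact fun h => h
        · convert isOpen_ne_fun (hcont q) continuous_const using 1
          ext w
          simp only [mem_inter_iff, mem_compl_iff, mem_setOf_eq, hpq]
          tauto
    · set q := MvPolynomial.aeval (fun _ : Fin 1 => (Polynomial.X : Polynomial ℚ)) p with hq
      have hpq : ∀ w : Fin 1 → ℝ, MvPolynomial.aeval w p = Polynomial.aeval (w 0) q :=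
        aeval_eq_aeval_uni p
      by_cases hq0 : q = 0
      · refine ⟨1, one_ne_zero, ?_, ?_⟩
        · convert isOpen_empty
          ext w
          simp [hpq, hq0]
        · convert isOpen_univ
          ext w
          simp [hpq, hq0]
      · refine ⟨q, hq0, ?_, ?_⟩
        · convert isOpen_lt continuous_const (hcont q) using 1
          ext w
          simp only [mem_inter_iff, mem_setOf_eq, hpq]
          exact ⟨fun h => h.1, fun h => ⟨h, h.ne'⟩⟩
        · convert isOpen_lt (hcont q) continuous_const using 1
          ext w
          simp only [mem_inter_iff, mem_compl_iff, mem_setOf_eq, hpq, not_lt]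
          exact ⟨fun h => lt_of_le_of_ne h.1 h.2, fun h => ⟨h.le, h.ne⟩⟩
  | bot => exact ⟨1, one_ne_zero, by simp, by simp⟩
  | sup S _ T _ ihS ihT =>
    obtain ⟨p, hp, hp1, hp2⟩ := ihS
    obtain ⟨q, hq, hq1, hq2⟩ := ihT
    refine ⟨p * q, mul_ne_zero hp hq, ?_, ?_⟩
    · have : ((S ⊔ T) ∩ {w : Fin 1 → ℝ | Polynomial.aeval (w 0) (p * q) ≠ 0}) =
          (S ∩ {w | Polynomial.aeval (w 0) p ≠ 0}) ∩ {w | Polynomial.aeval (w 0) q ≠ 0} ∪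
            (T ∩ {w | Polynomial.aeval (w 0) q ≠ 0}) ∩ {w | Polynomial.aeval (w 0) p ≠ 0} := by
        ext w
        simp only [sup_eq_union, mem_inter_iff, mem_union, mem_setOf_eq, map_mul, mul_ne_zero_iff]
        tauto
      rw [this]
      exact (hp1.inter (isOpen_ne_fun (hcont q) continuous_const)).union
        (hq1.inter (isOpen_ne_fun (hcont p) continuous_const))
    · have : ((S ⊔ T)ᶜ ∩ {w : Fin 1 → ℝ | Polynomial.aeval (w 0) (p * q) ≠ 0}) =
          (Sᶜ ∩ {w | Polynomial.aeval (w 0) p ≠ 0}) ∩ (Tᶜ ∩ {w | Polynomial.aeval (w 0) q ≠ 0}) := by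
        ext w
        simp only [sup_eq_union, compl_union, mem_inter_iff, mem_compl_iff, mem_setOf_eq, map_mul,
          mul_ne_zero_iff]
        tauto
      rw [this]
      exact hp2.inter hq2
  | compl S _ ih =>
    obtain ⟨p, hp, h1, h2⟩ := ih
    exact ⟨p, hp, h2, by simpa only [compl_compl] using h1⟩

/-- **A `ℚ`-semialgebraic point of `ℝ¹` is algebraic**: if `{w₀}` is `ℚ`-semialgebraic then
`w₀` is a root of the non-zero rational polynomial of `exists_clopen_off_zeros` (otherwise `{w₀}`
would contain an interval). [folklore] -/
theorem isAlgebraic_of_isSemialgebraic_singleton {w₀ : Fin 1 → ℝ}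
    (h : IsSemialgebraic ℚ ({w₀} : Set (Fin 1 → ℝ))) : IsAlgebraic ℚ (w₀ 0) := by
  obtain ⟨q, hq0, hopen, -⟩ := exists_clopen_off_zeros h
  by_cases hroot : Polynomial.aeval (w₀ 0) q = 0
  · exact ⟨q, hq0, hroot⟩
  · exfalso
    have hmem : w₀ ∈ ({w₀} : Set (Fin 1 → ℝ)) ∩ {w | Polynomial.aeval (w 0) q ≠ 0} := ⟨rfl, hroot⟩
    obtain ⟨ε, hε, hball⟩ := Metric.isOpen_iff.mp hopen w₀ hmem
    have hmem' : (fun _ => w₀ 0 + ε / 2 : Fin 1 → ℝ) ∈ Metric.ball w₀ ε := by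
      rw [Metric.mem_ball, dist_pi_lt_iff hε]
      intro i
      rw [Subsingleton.elim i 0, Real.dist_eq, add_sub_cancel_left, abs_of_pos (half_pos hε)]
      exact half_lt_self hε
    have h0 := congr_fun (mem_singleton_iff.mp (hball hmem').1) 0
    simp only [add_eq_left] at h0
    exact absurd h0 (half_pos hε).ne'

/-- **Semialgebraic functions take algebraic values at rational points** (slice the graph at the
rational point by a polynomial substitution — `IsSemialgebraic.preimage_aeval`, no
Tarski–Seidenberg — and apply `isAlgebraic_of_isSemialgebraic_singleton`). [folklore] -/
theorem isAlgebraic_apply_ratCast {m : ℕ} {s : Set (Fin m → ℝ)} {f : (Fin m → ℝ) → ℝ}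
    (hf : IsSemialgebraicFunOn ℚ s f) (z : Fin m → ℚ) (hz : (fun i => (z i : ℝ)) ∈ s) :
    IsAlgebraic ℚ (f fun i => (z i : ℝ)) := by
  rw [isSemialgebraicFunOn_iff] at hf
  set P : Fin (m + 1) → MvPolynomial (Fin 1) ℚ :=
    Fin.snoc (fun i => MvPolynomial.C (z i)) (MvPolynomial.X 0) with hPdef
  have hP : ∀ v : Fin 1 → ℝ,
      (fun j => MvPolynomial.aeval v (P j)) = Fin.snoc (fun i => (z i : ℝ)) (v 0) := by
    intro v
    ext j
    refine Fin.lastCases ?_ (fun i => ?_) j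
    · simp [hPdef]
    · simp [hPdef]
  have hT := hf.preimage_aeval P
  have hsing : IsSemialgebraic ℚ ({fun _ : Fin 1 => f (fun i => (z i : ℝ))} : Set (Fin 1 → ℝ)) := by
    convert hT using 1
    ext v
    simp only [mem_singleton_iff, mem_preimage, mem_setOf_eq, hP v, Fin.init_snoc, Fin.snoc_last]
    constructor
    · rintro rfl
      exact ⟨hz, rfl⟩
    · rintro ⟨-, hv⟩
      funext i
      rw [Subsingleton.elim i 0]
      exact hv
  exact isAlgebraic_of_isSemialgebraic_singleton hsing

/-- `(1/2)^q` is algebraic for rational `q`. [folklore] -/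
theorem isAlgebraic_half_rpow (q : ℚ) : IsAlgebraic ℚ ((1 / 2 : ℝ) ^ (q : ℝ)) := by
  have h := KoblitzOgus.isAlgebraic_nat_rpow_rat (m := 2) two_pos q.num q.den_pos
  have hq : ((q.num : ℝ) / (q.den : ℕ)) = (q : ℝ) := by
    rw [Rat.cast_def]
  rw [hq, Nat.cast_ofNat] at h
  rw [one_div, Real.inv_rpow (by norm_num : (0 : ℝ) ≤ 2)]
  exact h.inv

/-- **`IsAlgebraic ℚ c` is implied by the pinning of `r'`.** If some representation `r'` is
pinned as `[ball × cube, c · k! · Π …]` then `c` is algebraic: evaluate the (semialgebraic)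
integrand at the rational point `(0,…,0,½,…,½)` of the domain. So this hypothesis of the crux
is decoration (it can be neither load-bearing nor a source of vacuity). [folklore] -/
theorem isAlgebraic_of_isBallCubeRep {N' k : ℕ} {x' y' : Fin N' → ℚ} {c : ℝ}
    {r' : IntegralRep (2 * k + N')} (hr' : IsBallCubeRep k x' y' c r') : IsAlgebraic ℚ c := by
  set z : Fin (2 * k + N') → ℚ :=
    Fin.append (fun _ : Fin (2 * k) => (0 : ℚ)) (fun _ : Fin N' => 1 / 2) with hzdef
  have hzl : ∀ i : Fin (2 * k), z (Fin.castAdd N' i) = 0 := fun i => by simp [hzdef]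
  have hzr : ∀ l : Fin N', z (Fin.natAdd (2 * k) l) = 1 / 2 := fun l => by simp [hzdef]
  have h12 : ∀ l : Fin N', ((z (Fin.natAdd (2 * k) l) : ℚ) : ℝ) = 1 / 2 := fun l => by
    rw [hzr]; norm_num
  have hz : (fun i => (z i : ℝ)) ∈ r'.domain := by
    rw [hr'.1]
    refine ⟨?_, fun l => ?_⟩
    · simp [hzl]
    · simp only [mem_Ioo, h12]
      norm_num
  -- the value of the integrand there
  set A : ℝ := (k.factorial : ℝ) *
    ∏ l : Fin N', ((1 / 2 : ℝ) ^ ((x' l : ℝ) - 1) * (1 / 2 : ℝ) ^ ((y' l : ℝ) - 1)) with hA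
  have hval : r'.integrand (fun i => (z i : ℝ)) = c * A := by
    rw [hr'.2 hz]
    simp only [h12, hA]
    ring
  have halg : IsAlgebraic ℚ (c * A) := by
    rw [← hval]
    exact isAlgebraic_apply_ratCast r'.isSemialgebraicFunOn_integrand z hz
  -- `A` is algebraic and non-zero
  have hApos : 0 < A := by
    refine mul_pos (by exact_mod_cast Nat.factorial_pos k) (Finset.prod_pos fun l _ => ?_)
    exact mul_pos (Real.rpow_pos_of_pos (by norm_num) _) (Real.rpow_pos_of_pos (by norm_num) _)
  have hAalg : IsAlgebraic ℚ A := by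
    rw [isAlgebraic_iff_isIntegral]
    refine IsIntegral.mul (isAlgebraic_iff_isIntegral.mp (isAlgebraic_nat _)) ?_
    refine IsIntegral.prod _ fun l _ => IsIntegral.mul ?_ ?_
    · have h := isAlgebraic_half_rpow (x' l - 1)
      rw [Rat.cast_sub, Rat.cast_one] at h
      exact isAlgebraic_iff_isIntegral.mp h
    · have h := isAlgebraic_half_rpow (y' l - 1)
      rw [Rat.cast_sub, Rat.cast_one] at h
      exact isAlgebraic_iff_isIntegral.mp h
  have hc : c = c * A * A⁻¹ := by field_simp
  rw [hc]
  exact halg.mul hAalg.inv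

/-- Hence the crux is equivalent to its version WITHOUT the algebraicity hypothesis. [folklore] -/
theorem gammaHodgeSector_iff_without_isAlgebraic :
    GammaHodgeSector ↔
      ∀ (N N' k : ℕ) (x y : Fin N → ℚ) (x' y' : Fin N' → ℚ) (c : ℝ),
        Admissible x y → Admissible x' y' → HodgeCondition N N' k x y x' y' →
        ∀ (r : IntegralRep N) (r' : IntegralRep (2 * k + N')),
          IsCubeBetaRep x y r → IsBallCubeRep k x' y' c r' → r.value = r'.value → Equivalent r r' := by
  rw [gammaHodgeSector_iff]
  constructor
  · intro h N N' k x y x' y' c hx hx' hH r r' hr hr' hv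
    exact h N N' k x y x' y' c hx hx' hH (isAlgebraic_of_isBallCubeRep hr') r r' hr hr' hv
  · intro h N N' k x y x' y' c hx hx' hH _ r r' hr hr' hv
    exact h N N' k x y x' y' c hx hx' hH r r' hr hr' hv

end Algebraicity



end Summit.KontsevichZagierPeriods.GammaHodgeSectorNegative
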